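import Summits.ABC.IUTFork.Conditional.InhUniformBandFrey31117999167337103924704Level1322641
import Summits.ABC.IUTFork.Conditional.WRowHexLamSevenTenLevel4723
import Summits.ABC.IUTFork.Conditional.WRowHexLamSevenFifteenAllLevels
import Summits.ABC.IUTFork.Conditional.WRowHexLamSevenSixteenAllLevels
import Summits.ABC.IUTFork.Conditional.AbcOfSCor312OfInhBands
import Summits.ABC.IUTFork.Conditional.AbcOfSCor312OfHexBands
import HarnessLib

/-!
# Branch C — the NUMBER-LEVEL typed [IUTchIII] Cor. 3.12 in READING (U) (`T.Cor312Of`) TRUE, NO hypothesis, at the two formerly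
# OPEN-AS-TYPED single primes — the 67-triple at `l = 1,322,641` and HEX `k = 10` at `l = 4723` — hence on their WHOLE inhabited half-axes
# with NO exception; and on the inhabited half-axes of HEX `k = 15, 16` (`l ≥ 617,647 / 329,281`)

C scoreboard (abc-iut-C-cert-3 gen 5, INTAKE / CERTS pen). PROOF-ONLY junction file (no `def`, no new `Prop`, no instance, no notation; nothing
re-typed); sequel of `AbcOfSCor312OfInhBands` (p508961) / `AbcOfSCor312OfHexBands(B)` (p498110 / p513951) with the SAME recipe:
`<licence theorem> ∘ GenuineK.cor312Of_of_licence (p435505) ∘ negLogTheta_settingPrVolSharp_pilotDataOfK_le_datum (p447368)` at one-point context data.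
Inputs BY NAME: abc-iut-W-neg-1 g5's «OPEN-SINGLE-PRIMES» ceiling-level licences `WRow.licence_frey31117999167337103924704_level1322641` (p513131)
and `WRow.licence_lamSeven_ten_level4723` (p513015) — both through the +1-radius inner witness `WRow.inner_witness_ceil` (p511165) and the socket
`WRow.licence_triple_unconditional_ceil` (p512367), C-R107 (a) — and abc-iut-C-cert-1 g8's «W:HEX-AXIS-REST» (I) licences
`WRow.licence_lamSeven_fifteen_all` (p513317) / `…_sixteen_all` (p513318), C-R107 (b). The glue theorems put the single levels together with the
uniform bands already in the (U) books: 67-triple `Frey31117999167337103924704.cor312Of_uniform` (l ≥ 1,322,706) + `…_levels`-free form below gives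
«every prime l ≥ 1,322,641 except the four exact-cell levels, which are theorems of W-neg-1 g4 (p507992) not yet in (U) form» — so the ALL-PRIMES
glue is stated from the pieces that ARE in (U) form: l = 1,322,641 ∨ l ≥ 1,322,706; and HEX k = 10: l = 4723 ∨ l ≥ 4729 = every prime l ≥ 4723.

READING (numbers, no side): §T.7 (A)/(B)'s last open primes are now (U)-theorems too; NO height bound (known data); records UNCHANGED (K p460293 ·
p460539 · p464272 · γ p462946; M twins); non-emptiness / admissibility / (P6) at these levels NOT claimed; inhabited-as-typed ≠ true-in-print;
typed ≠ proved; instantiated ≠ endorsed; not a claim that abc is proved or refuted; no side taken on [IUTchIII] Cor 3.12 / [IUTchIV] Thm 1.10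
or on any author. [cite: Mochizuki2012, IUTchIII Cor. 3.12 p. 173–174, Step (xi-f) p. 184; IUTchIV Thm. 1.10 p. 22–23, Cor. 2.2 (ii) proof (P5)(P7)
p. 46; IUTchI Ex. 3.2 (iv) p. 71] [cite: DupuyHilado2025, §3.3, §3.4] [claim: Mochizuki2012, status: disputed]
-/

noncomputable section

open Set Function NumberField IsDedekindDomain

namespace Summit.ABC.IUTFork.Conditional

open Thm311 Thm311.Real Cor312 Cor312Vol Cor312Prov Literature.IUT.LogThetaLattice Literature.IUT.LogVolume
  Literature.IUT.HodgeTheaters Literature.IUT.LogVolume.ThetaData Literature.IUT.LogVolume.Cor22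
open Literature.NumberTheory.NumberFields Literature.NumberTheory.GaloisRepresentations.Ultrametric
open Literature.NumberTheory.DiophantineGeometry Literature.NumberTheory.DiophantineGeometry.GenEll Summit.ABC.ABC.Theorems

/-- **67-triple `2⁵67⁸107·22381 + 5⁴53⁶353⁵ = 3²²7¹⁴43·83` at the formerly open-as-typed prime `l = 1,322,641`: `T.Cor312Of` for every genuine datum, NO hypothesis** — W-neg-1 g5's ceiling-level licence p513131. [cite: Mochizuki2012, IUTchIII Cor. 3.12 p. 173–174; IUTchIV Cor. 2.2 (ii) proof (P5) p. 46] [claim: Mochizuki2012, status: disputed] -/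
theorem Frey31117999167337103924704.cor312Of_level1322641 {l : ℕ} (hl : l = 1322641)
    (T : Cor22.ThetaVolumeDatumAt (ratPoint (((2 ^ 5 * 67 ^ 8 * 107 * 22381 : ℕ) : ℚ) / (3 ^ 22 * 7 ^ 14 * 43 * 83 : ℕ))) l) : T.Cor312Of := by
  letI := T.instFieldF; letI := T.instNumberFieldF; letI := T.instAlgebraF; letI := T.instFieldK
  letI := T.instNumberFieldK; letI := T.instAlgebraK; letI := T.instFieldFbar; letI := T.instAlgebraFbar
  letI := T.instAlgebraKFbar; letI := T.instIsElliptic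
  obtain ⟨tq, htq0, htq1, htq⟩ := exists_realising_qIdeles_pilotDataOfK T.D
  obtain ⟨t, ht0, ht1, ht⟩ := exists_realising_thetaIdeles_pilotDataOfK T.D
  exact GenuineK.cor312Of_of_licence T.D T.K ℚ (fun _ _ => ∅) (fun _ _ => ∅) (fun _ _ _ => ∅) (fun _ _ _ => 0) (fun _ _ => ∅)
    (fun _ _ _ _ => ∅) 0 unitLatticeDH (unitSigDH (pilotDataOfK T.D T.K)) (unitSplitDH (pilotDataOfK T.D T.K))
    (unitQDataDH (pilotDataOfK T.D T.K)) t tq T.isVolumeInputOf htq0 htq1 ht0 ht1 htq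
    (WRow.licence_frey31117999167337103924704_level1322641 hl T (logvAnalytic_analyticLogv (F := T.K)) ℚ (fun _ _ => ∅) (fun _ _ => ∅) (fun _ _ _ => ∅)
      (fun _ _ _ => 0) (fun _ _ => ∅) (fun _ _ _ _ => ∅) 0 unitLatticeDH (unitSigDH (pilotDataOfK T.D T.K)) (unitSplitDH (pilotDataOfK T.D T.K))
      (unitQDataDH (pilotDataOfK T.D T.K)) tq t htq0 htq1 ht0 ht htq)
    (negLogTheta_settingPrVolSharp_pilotDataOfK_le_datum T ℚ (fun _ _ => ∅) (fun _ _ => ∅) (fun _ _ _ => ∅) (fun _ _ _ => 0) (fun _ _ => ∅)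
      (fun _ _ _ _ => ∅) 0 unitLatticeDH (unitSigDH (pilotDataOfK T.D T.K)) (unitSplitDH (pilotDataOfK T.D T.K)) (unitQDataDH (pilotDataOfK T.D T.K))
      tq t htq0 htq1 ht0 ht)

/-- **HEX `k = 10` at the formerly open-as-typed prime `l = 4723`: `T.Cor312Of` for every genuine datum over `ratPoint (½ + 2/7^10)`, NO hypothesis** — W-neg-1 g5's ceiling-level licence p513015. [cite: Mochizuki2012, IUTchIII Cor. 3.12 p. 173–174; IUTchIV Cor. 2.2 (ii) proof (P5) p. 46] [claim: Mochizuki2012, status: disputed] -/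
theorem Hex.cor312Of_lamSeven_ten_level4723 {k l : ℕ} (hk : k = 10) (hl : l = 4723)
    (T : Cor22.ThetaVolumeDatumAt (ratPoint ((2 : ℚ)⁻¹ + 2 / 7 ^ k)) l) : T.Cor312Of := by
  letI := T.instFieldF; letI := T.instNumberFieldF; letI := T.instAlgebraF; letI := T.instFieldK
  letI := T.instNumberFieldK; letI := T.instAlgebraK; letI := T.instFieldFbar; letI := T.instAlgebraFbar
  letI := T.instAlgebraKFbar; letI := T.instIsElliptic
  obtain ⟨tq, htq0, htq1, htq⟩ := exists_realising_qIdeles_pilotDataOfK T.D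
  obtain ⟨t, ht0, ht1, ht⟩ := exists_realising_thetaIdeles_pilotDataOfK T.D
  exact GenuineK.cor312Of_of_licence T.D T.K ℚ (fun _ _ => ∅) (fun _ _ => ∅) (fun _ _ _ => ∅) (fun _ _ _ => 0) (fun _ _ => ∅)
    (fun _ _ _ _ => ∅) 0 unitLatticeDH (unitSigDH (pilotDataOfK T.D T.K)) (unitSplitDH (pilotDataOfK T.D T.K))
    (unitQDataDH (pilotDataOfK T.D T.K)) t tq T.isVolumeInputOf htq0 htq1 ht0 ht1 htq
    (WRow.licence_lamSeven_ten_level4723 hk hl T (logvAnalytic_analyticLogv (F := T.K)) ℚ (fun _ _ => ∅) (fun _ _ => ∅) (fun _ _ _ => ∅)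
      (fun _ _ _ => 0) (fun _ _ => ∅) (fun _ _ _ _ => ∅) 0 unitLatticeDH (unitSigDH (pilotDataOfK T.D T.K)) (unitSplitDH (pilotDataOfK T.D T.K))
      (unitQDataDH (pilotDataOfK T.D T.K)) tq t htq0 htq1 ht0 ht htq)
    (negLogTheta_settingPrVolSharp_pilotDataOfK_le_datum T ℚ (fun _ _ => ∅) (fun _ _ => ∅) (fun _ _ _ => ∅) (fun _ _ _ => 0) (fun _ _ => ∅)
      (fun _ _ _ _ => ∅) 0 unitLatticeDH (unitSigDH (pilotDataOfK T.D T.K)) (unitSplitDH (pilotDataOfK T.D T.K)) (unitQDataDH (pilotDataOfK T.D T.K))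
      tq t htq0 htq1 ht0 ht)

/-- **HEX `k = 15`, every prime `l ≥ 617,647`: `T.Cor312Of`, NO hypothesis** — C-cert-1 g8's `WRow.licence_lamSeven_fifteen_all` (p513317; REF half every prime 11 ≤ l ≤ 617,587, p513315). [cite: Mochizuki2012, IUTchIII Cor. 3.12 p. 173–174; IUTchIV Cor. 2.2 (ii) proof (P5) p. 46] [claim: Mochizuki2012, status: disputed] -/
theorem Hex.cor312Of_lamSeven_fifteen_all {k l : ℕ} (hk : k = 15) (hl : l.Prime) (hl0 : 617647 ≤ l)
    (T : Cor22.ThetaVolumeDatumAt (ratPoint ((2 : ℚ)⁻¹ + 2 / 7 ^ k)) l) : T.Cor312Of := by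
  letI := T.instFieldF; letI := T.instNumberFieldF; letI := T.instAlgebraF; letI := T.instFieldK
  letI := T.instNumberFieldK; letI := T.instAlgebraK; letI := T.instFieldFbar; letI := T.instAlgebraFbar
  letI := T.instAlgebraKFbar; letI := T.instIsElliptic
  obtain ⟨tq, htq0, htq1, htq⟩ := exists_realising_qIdeles_pilotDataOfK T.D
  obtain ⟨t, ht0, ht1, ht⟩ := exists_realising_thetaIdeles_pilotDataOfK T.D
  exact GenuineK.cor312Of_of_licence T.D T.K ℚ (fun _ _ => ∅) (fun _ _ => ∅) (fun _ _ _ => ∅) (fun _ _ _ => 0) (fun _ _ => ∅)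
    (fun _ _ _ _ => ∅) 0 unitLatticeDH (unitSigDH (pilotDataOfK T.D T.K)) (unitSplitDH (pilotDataOfK T.D T.K))
    (unitQDataDH (pilotDataOfK T.D T.K)) t tq T.isVolumeInputOf htq0 htq1 ht0 ht1 htq
    (WRow.licence_lamSeven_fifteen_all hk hl hl0 T (logvAnalytic_analyticLogv (F := T.K)) ℚ (fun _ _ => ∅) (fun _ _ => ∅) (fun _ _ _ => ∅)
      (fun _ _ _ => 0) (fun _ _ => ∅) (fun _ _ _ _ => ∅) 0 unitLatticeDH (unitSigDH (pilotDataOfK T.D T.K)) (unitSplitDH (pilotDataOfK T.D T.K))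
      (unitQDataDH (pilotDataOfK T.D T.K)) tq t htq0 htq1 ht0 ht htq)
    (negLogTheta_settingPrVolSharp_pilotDataOfK_le_datum T ℚ (fun _ _ => ∅) (fun _ _ => ∅) (fun _ _ _ => ∅) (fun _ _ _ => 0) (fun _ _ => ∅)
      (fun _ _ _ _ => ∅) 0 unitLatticeDH (unitSigDH (pilotDataOfK T.D T.K)) (unitSplitDH (pilotDataOfK T.D T.K)) (unitQDataDH (pilotDataOfK T.D T.K))
      tq t htq0 htq1 ht0 ht)

/-- **HEX `k = 16`, every prime `l ≥ 329,281`: `T.Cor312Of`, NO hypothesis** — C-cert-1 g8's `WRow.licence_lamSeven_sixteen_all` (p513318; REF half every prime 11 ≤ l ≤ 329,269, p513316). [cite: Mochizuki2012, IUTchIII Cor. 3.12 p. 173–174; IUTchIV Cor. 2.2 (ii) proof (P5) p. 46] [claim: Mochizuki2012, status: disputed] -/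
theorem Hex.cor312Of_lamSeven_sixteen_all {k l : ℕ} (hk : k = 16) (hl : l.Prime) (hl0 : 329281 ≤ l)
    (T : Cor22.ThetaVolumeDatumAt (ratPoint ((2 : ℚ)⁻¹ + 2 / 7 ^ k)) l) : T.Cor312Of := by
  letI := T.instFieldF; letI := T.instNumberFieldF; letI := T.instAlgebraF; letI := T.instFieldK
  letI := T.instNumberFieldK; letI := T.instAlgebraK; letI := T.instFieldFbar; letI := T.instAlgebraFbar
  letI := T.instAlgebraKFbar; letI := T.instIsElliptic
  obtain ⟨tq, htq0, htq1, htq⟩ := exists_realising_qIdeles_pilotDataOfK T.D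
  obtain ⟨t, ht0, ht1, ht⟩ := exists_realising_thetaIdeles_pilotDataOfK T.D
  exact GenuineK.cor312Of_of_licence T.D T.K ℚ (fun _ _ => ∅) (fun _ _ => ∅) (fun _ _ _ => ∅) (fun _ _ _ => 0) (fun _ _ => ∅)
    (fun _ _ _ _ => ∅) 0 unitLatticeDH (unitSigDH (pilotDataOfK T.D T.K)) (unitSplitDH (pilotDataOfK T.D T.K))
    (unitQDataDH (pilotDataOfK T.D T.K)) t tq T.isVolumeInputOf htq0 htq1 ht0 ht1 htq
    (WRow.licence_lamSeven_sixteen_all hk hl hl0 T (logvAnalytic_analyticLogv (F := T.K)) ℚ (fun _ _ => ∅) (fun _ _ => ∅) (fun _ _ _ => ∅)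
      (fun _ _ _ => 0) (fun _ _ => ∅) (fun _ _ _ _ => ∅) 0 unitLatticeDH (unitSigDH (pilotDataOfK T.D T.K)) (unitSplitDH (pilotDataOfK T.D T.K))
      (unitQDataDH (pilotDataOfK T.D T.K)) tq t htq0 htq1 ht0 ht htq)
    (negLogTheta_settingPrVolSharp_pilotDataOfK_le_datum T ℚ (fun _ _ => ∅) (fun _ _ => ∅) (fun _ _ _ => ∅) (fun _ _ _ => 0) (fun _ _ => ∅)
      (fun _ _ _ _ => ∅) 0 unitLatticeDH (unitSigDH (pilotDataOfK T.D T.K)) (unitSplitDH (pilotDataOfK T.D T.K)) (unitQDataDH (pilotDataOfK T.D T.K))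
      tq t htq0 htq1 ht0 ht)

/-- **GLUE, HEX `k = 10`: for EVERY prime `l ≥ 4723` and every genuine datum over `ratPoint (½ + 2/7^10)`, `T.Cor312Of`** — `l = 4723` by the ceiling
level above, `l ≥ 4729` by `Hex.cor312Of_lamSeven_ten_all` (p508961); 4724–4728 contain no prime. With the REF half p508090 (every prime 11 ≤ l ≤ 4721)
the whole HEX-10 axis is two-sided in kernel with NO exception. [cite: Mochizuki2012, IUTchIII Cor. 3.12 p. 173–174] [claim: Mochizuki2012, status: disputed] -/
theorem Hex.cor312Of_lamSeven_ten_of_le_4723 {l : ℕ} (hl : l.Prime) (hl0 : 4723 ≤ l)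
    (T : Cor22.ThetaVolumeDatumAt (ratPoint ((2 : ℚ)⁻¹ + 2 / 7 ^ 10)) l) : T.Cor312Of := by
  by_cases h : l = 4723
  · exact Hex.cor312Of_lamSeven_ten_level4723 rfl h T
  · have h9 : 4729 ≤ l := by
      by_contra hlt
      rw [not_le] at hlt
      interval_cases l <;> first | exact absurd rfl h | exact absurd hl (by norm_num)
    exact Hex.cor312Of_lamSeven_ten_all rfl hl h9 T

/-- **GLUE, 67-triple: at `l = 1,322,641` and at every level `l ≥ 1,322,706`, `T.Cor312Of` for every genuine datum** — the ceiling level above ∨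
`Frey31117999167337103924704.cor312Of_uniform` (p508961); the four exact-cell levels 1,322,669 / 681 / 689 / 693 in between are W-neg-1 g4's
`WRow.licence_frey31117999167337103924704_levels` (p507992) and are NOT restated here. [cite: Mochizuki2012, IUTchIII Cor. 3.12 p. 173–174]
[claim: Mochizuki2012, status: disputed] -/
theorem Frey31117999167337103924704.cor312Of_level_or_uniform {l : ℕ} (hl : l = 1322641 ∨ 1322706 ≤ l)
    (T : Cor22.ThetaVolumeDatumAt (ratPoint (((2 ^ 5 * 67 ^ 8 * 107 * 22381 : ℕ) : ℚ) / (3 ^ 22 * 7 ^ 14 * 43 * 83 : ℕ))) l) :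
    T.Cor312Of := by
  rcases hl with h | h
  · exact Frey31117999167337103924704.cor312Of_level1322641 h T
  · exact Frey31117999167337103924704.cor312Of_uniform h T

end Summit.ABC.IUTFork.Conditional

end
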